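import Literature.MathematicalPhysics.QuantumFieldTheory.SU2CharacterConvolution
import HarnessLib

/-!
# Tomboulis's decimation at `r = 1` (`d = 4`) IS Ito–Seiler's functional Migdal–Kadanoff recursion; Ito's uniform
# flow for every positive `C²` class datum; hypothesis (H_flow) of `ConfinementFromIneq516` discharged at `r = 1`

Theorem-only sequel to `SU2CharacterConvolution` (whose §6 proved `f_c ∗ f_{c'} = f_{cc'}` and the positivity of the
decimated plaquette functions) and to `ItoTheoremSU2` (Ito's 1987 curvature argument for Wilson's datum).

* §7  bookkeeping: `∫ f_c dU = 1` (`integral_plaqFn`), `χ_j(𝟙) = d_j` (`su2Char_apply_one`), and **the norm (2.11) is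
  `‖g‖ = f_c(𝟙) - 1`** (`coeffNorm_eq_plaqFn_one_sub_one`).
* §8  **`mkStepFun b f_c = f_{c(1)}`** (`mkStepFun_plaqFn`): Ito–Seiler's functional step (arXiv:0711.4930 (2.2)–(2.3):
  power `b^{D-2} = b²`, `b²` convolutions, normalisation) on a plaquette function with `c_j ≥ 0` is the plaquette
  function of Tomboulis's decimated coefficients (arXiv:0707.2179 (2.18)–(2.22)) at `r = 1`, `ζ = b²`, cut-off `b²J`;
  iterated, `f_c^{(m)} = f_{c^U(m)}` along the upper-bound column of scheme (3.38) (`mkIterFun_plaqFn`, `d = 4`), so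
  `‖g^U(m)‖ = f_c^{(m)}(𝟙) - 1` (`coeffNorm_upperCoeffIter_four_one`) and (3.43) follows from convergence of the iterates
  at the identity (`upperFlowInNorm_four_one_of_tendsto`).
* §9  **Ito's Theorem 4 for an ARBITRARY positive `C²` class datum** with bounded fibre curvature and `∫ f = 1`
  (`mkIterFun_spec_of_curv`, `mkIterFun_tendstoUniformly_one_of_curv`): the induction of `ItoTheoremSU2.mkIterFun_spec`
  verbatim with `2β` replaced by the datum's curvature bound `B₀` (Ito, CMP 110 (1987) §3 (13)–(24); the one-step
  contraction `ItoSU2.mkStep_spec` and the two-sided bound `ItoSU2.exists_bounds_of_curv` are the tree's).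
* §10 **a positive truncated plaquette function is an Ito datum** (`plaqFn_itoDatum`: `f_c = P_c(u₀)` is a class
  function, `C²` along the `σ₃`-fibres with `f₁ = P'_c(u₀)u₃`, `f₂ = P''_c(u₀)u₃² - P'_c(u₀)u₀`, curvature bounded by
  compactness), hence `f_c^{(n)} → 1` uniformly (`mkIterFun_plaqFn_tendstoUniformly_one`), hence **(H_flow)
  `UpperFlowInNorm 4 J c b 1` is a THEOREM** for `c_j ≥ 0`, `f_c > 0`, `b ≥ 2` (`upperFlowInNorm_four_one`), and the
  chain «(5.16) ⟹ confinement» at `r = 1`, `d = 4` keeps only (H_sc), Appendix C's claim and (5.16) as premises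
  (`electricFluxAreaLawAlong_of_chain_four`).
* §11 **concordance**: Tomboulis's (3.43) at `r = 1` ⟺ Ito's uniform flow (`upperFlowInNorm_four_one_iff_tendstoUniformly`,
  via `sup|f_c - 1| ≤ ‖g‖`, `abs_plaqFn_sub_one_le_coeffNorm`); the character coefficients of a plaquette function
  (`charCoeff_plaqFn`); **Ito–Seiler's Thm 2.1 for every positive truncated datum** (`mkFlowToStrongCoupling_plaqFn`;
  the tree's `itoTheoremSU2_holds` is the untruncated Wilson datum).

Scope, honestly: `SU(2)`, `D = 4` (`ζ = b²`), `r = 1`, integer `b ≥ 2` (resp. `b ≥ 1` for the algebraic identities),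
initial coefficients `c_j ≥ 0` with cut-off `J` and `f_c > 0` on `SU(2)`; Tomboulis's `r < 1` columns and the
`d`-dimensional `ζ = b^{d-2} ≠ b²` recursions are NOT covered (Ito's marginal cancellation is special to `ζ = b²`).
No definitions, no named facts.

## References
* [Ito1987HierarchicalHeisenberg] K. R. Ito, Commun. Math. Phys. **110** (1987) 237–246, §3 eqs. (13)–(24), Thm. 4.
* [ItoSeiler2007Tomboulis] K. R. Ito, E. Seiler, arXiv:0711.4930, §2 eqs. (2.1)–(2.3), Thm. 2.1.
* [Tomboulis2007Confinement] E. T. Tomboulis, arXiv:0707.2179, §2 eqs. (2.3), (2.8)–(2.11), (2.18)–(2.22); §3.4 scheme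
  (3.38), eq. (3.43); §5; §6.2; App. C.
* [ItoSeiler2009Critical] K. R. Ito, E. Seiler, arXiv:0803.3019, §§2, 4(b), 5.
* [BrockerTomDieck1985] II (4.11)(i) (`∫ χ_n = δ_{n0}`).
-/


noncomputable section

open Real MeasureTheory Set Filter Function Finset
open scoped Topology BigOperators

namespace Literature.MathematicalPhysics.QuantumFieldTheory

namespace Tomboulis2007

open MullerSchiemann1987.HeatKernel (diagPhase diagPhase_add diagPhase_zero u0 u3 u0_diagPhase_mul
  u3_diagPhase_mul continuous_u0 continuous_u3 abs_u0_le_one u0_one u3_one)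
open MullerSchiemann1987.ClassFunctionsSU2 (continuous_diagPhase u0_conj)

/-! ### §7 Convolution bookkeeping: `∫ f_c = 1`, `χ_j(𝟙) = d_j`, `‖g‖ = f(𝟙) - 1` -/

/-- The characters are continuous (plumbing). [folklore] -/
private theorem continuous_su2Char₃ (n : ℕ) : Continuous (su2Char n) := by
  have h : su2Char n = fun U => (Polynomial.Chebyshev.U ℝ (n : ℤ)).eval (u0 U) :=
    funext (ItoSU2.su2Char_eq_eval_u0 n)
  rw [h]
  exact (Polynomial.continuous _).comp continuous_u0

/-- Continuous real functions on `SU(2)` are Haar integrable (plumbing). [folklore] -/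
private theorem integrable_of_continuous₃ {f : SU2 → ℝ} (hf : Continuous f) :
    Integrable f (haarProbability SU2) :=
  hf.integrable_of_hasCompactSupport (HasCompactSupport.of_compactSpace _)

/-- Homogeneity of the convolution in both factors (plumbing). [folklore] -/
private theorem convSU2_const_mul (a a' : ℝ) (g h : SU2 → ℝ) (U : SU2) :
    convSU2 (fun V => a * g V) (fun V => a' * h V) U = a * a' * convSU2 g h U := by
  unfold convSU2
  rw [← integral_const_mul]
  refine integral_congr_ae (Filter.Eventually.of_forall fun V => ?_)
  simp only
  ring

/-- Homogeneity of convolution powers: `(a g)^{∗(k+1)} = a^{k+1} g^{∗(k+1)}` (plumbing). [folklore] -/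
private theorem convPow_const_mul (a : ℝ) (g : SU2 → ℝ) :
    ∀ k : ℕ, convPow (fun V => a * g V) k = fun U => a ^ (k + 1) * convPow g k U
  | 0 => by funext U; simp [convPow]
  | k + 1 => by
    funext U
    simp only [convPow]
    rw [convPow_const_mul a g k]
    have hg : g = fun V => 1 * g V := funext fun V => (one_mul _).symm
    conv_lhs => rw [hg]
    rw [convSU2_const_mul]
    ring

/-- `∫ χ_m dU = [m = 0]` (orthonormality against `χ_0 = 1`). [cite: BrockerTomDieck1985, II (4.11)(i)] -/
theorem integral_su2Char_eq_ite (m : ℕ) :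
    ∫ U, su2Char m U ∂(haarProbability SU2) = if m = 0 then 1 else 0 := by
  have h := integral_su2Char_mul_su2Char m 0
  have h0 : ∀ U : SU2, su2Char 0 U = 1 := fun U => by simp [su2Char]
  simp_rw [h0, mul_one] at h
  exact h

/-- **The Haar integral of a plaquette function is its trivial coefficient**: `∫ f_c dU = 1` (the normalisation
`c_0 = 1` of arXiv:0707.2179 (2.3)/(2.9)). [cite: Tomboulis2007Confinement, §2 eqs. (2.3), (2.9)] -/
theorem integral_plaqFn (J : ℕ) (c : ℕ → ℝ) : ∫ U, plaqFn J c U ∂(haarProbability SU2) = 1 := by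
  simp_rw [plaqFn_eq_charSum J c]
  rw [integral_finsetSum _ (fun m _ => (integrable_of_continuous₃ (continuous_su2Char₃ m)).const_mul _)]
  simp_rw [integral_const_mul, integral_su2Char_eq_ite, mul_ite, mul_one, mul_zero]
  rw [Finset.sum_eq_single 0 (fun m _ hm => if_neg hm) (fun h => absurd (by simp) h)]
  simp

/-- **`χ_j(𝟙) = d_j`**: `su2Char n 𝟙 = n + 1` (`U_n(1) = n + 1`).  (Prints like the Summits-side Census
`su2Char_one_right` in `OneLinkConfiguration.lean` — acknowledged duplicate; Literature cannot import Summits.)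
[cite: Tomboulis2007Confinement, §2 after eq. (2.2) (d_j = 2j+1)] -/
theorem su2Char_apply_one (n : ℕ) : su2Char n (1 : SU2) = (n : ℝ) + 1 := by
  rw [ItoSU2.su2Char_eq_eval_u0, u0_one, Polynomial.Chebyshev.U_eval_one]
  push_cast
  ring

/-- **The norm (2.11) is `f(𝟙) - 1`**: `‖g‖ = Σ_{j≠0} d_j² c_j = f_c(𝟙) - 1` (as `χ_j(𝟙) = d_j`; no absolute values on
the standing domain `c_j ≥ 0`). [cite: Tomboulis2007Confinement, §2 eqs. (2.10)–(2.11)] -/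
theorem coeffNorm_eq_plaqFn_one_sub_one (J : ℕ) (c : ℕ → ℝ) : coeffNorm J c = plaqFn J c 1 - 1 := by
  unfold coeffNorm plaqFn
  simp_rw [su2Char_apply_one]
  rw [add_sub_cancel_left]
  exact Finset.sum_congr rfl fun k _ => by ring

/-! ### §8 `mkStepFun b f_c = f_{c(1)}` and `f_c^{(m)} = f_{c^U(m)}` (`d = 4`, `r = 1`) -/

/-- Convolution powers of `f_c^ζ`: `(f_c^ζ)^{∗(k+1)} = F̂_0^{k+1} · f_{ĉ^{k+1}}` with cut-off `ζJ`, `ĉ_j = F̂_j/F̂_0`.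
[cite: Tomboulis2007Confinement, §2 eqs. (2.18)–(2.22)] [cite: ItoSeiler2007Tomboulis, §2 eq. (2.3)] -/
theorem convPow_plaqFn_pow {J : ℕ} {c : ℕ → ℝ} (hc : ∀ n, 1 ≤ n → 0 ≤ c n) (ζ k : ℕ) :
    convPow (fun V => plaqFn J c V ^ ζ) k =
      fun U => mkFhat J c ζ 0 ^ (k + 1) *
        plaqFn (ζ * J) (fun n => (mkFhat J c ζ n / mkFhat J c ζ 0) ^ (k + 1)) U := by
  have h : (fun V => plaqFn J c V ^ ζ) =
      fun V => mkFhat J c ζ 0 * plaqFn (ζ * J) (fun n => mkFhat J c ζ n / mkFhat J c ζ 0) V :=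
    funext fun V => plaqFn_pow_eq_mkFhat_mul_plaqFn_hat hc ζ V
  rw [h, convPow_const_mul, convPow_plaqFn]

/-- **Ito–Seiler's functional Migdal–Kadanoff step on a plaquette function is Tomboulis's coefficient step at
`r = 1`** with `ζ = b²` (`D = 4`): `mkStepFun b f_c = f_{c(1)}`, `c_j(1) = (F̂_j/F̂_0)^{b²}` (2.19), cut-off `b²J`
(2.22) — for `c_j ≥ 0` and `b ≥ 1`. [cite: ItoSeiler2007Tomboulis, §2 eqs. (2.2)–(2.3)]
[cite: Tomboulis2007Confinement, §2 eqs. (2.18)–(2.22)] -/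
theorem mkStepFun_plaqFn {J : ℕ} {c : ℕ → ℝ} (hc : ∀ n, 1 ≤ n → 0 ≤ c n) {b : ℕ} (hb : 1 ≤ b) :
    mkStepFun b (plaqFn J c) = plaqFn (b ^ 2 * J) (mkCoeff J c (b ^ 2) b 1) := by
  obtain ⟨k, hk⟩ : ∃ k, b ^ 2 = k + 1 := ⟨b ^ 2 - 1, by have := Nat.one_le_pow 2 b hb; omega⟩
  have hk1 : b ^ 2 - 1 = k := by omega
  have h0 : mkFhat J c (b ^ 2) 0 ^ (k + 1) ≠ 0 := pow_ne_zero _ (mkFhat_zero_pos hc (b ^ 2)).ne'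
  have hcoef : mkCoeff J c (b ^ 2) b 1 = fun n => (mkFhat J c (b ^ 2) n / mkFhat J c (b ^ 2) 0) ^ (k + 1) := by
    funext n
    rw [mkCoeff_one_eq_pow, hk]
  funext U
  unfold mkStepFun
  rw [hk1, convPow_plaqFn_pow hc (b ^ 2) k]
  simp only [integral_const_mul, integral_plaqFn, mul_one]
  rw [mul_div_cancel_left₀ _ h0, hcoef]

/-- **Iterated**: `f_c^{(m)} = f_{c^U(m)}` — the `m`-th Ito–Seiler iterate of `f_c` is the plaquette function of
the `m`-th upper-bound column vector of scheme (3.38) at `r = 1`, `d = 4` (cut-off `b^{2m}J`).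
[cite: ItoSeiler2007Tomboulis, §2 eqs. (2.2)–(2.3)] [cite: Tomboulis2007Confinement, §3.4 scheme (3.38)] -/
theorem mkIterFun_plaqFn {J : ℕ} {c : ℕ → ℝ} (hc : ∀ n, 1 ≤ n → 0 ≤ c n) {b : ℕ} (hb : 1 ≤ b) :
    ∀ m : ℕ, mkIterFun b m (plaqFn J c) = plaqFn (cutoffIter 4 J b m) (upperCoeffIter 4 J c b 1 m)
  | 0 => rfl
  | m + 1 => by
    rw [mkIterFun_succ, mkIterFun_plaqFn hc hb m,
      mkStepFun_plaqFn (upperCoeffIter_nonneg (d := 4) (J := J) hc b 1 m) hb]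
    rfl

/-- **The norm along the upper-bound column is `f^{(m)}(𝟙) - 1`** (`d = 4`, `r = 1`).
[cite: Tomboulis2007Confinement, §2 eq. (2.11) and §3.4 scheme (3.38)] -/
theorem coeffNorm_upperCoeffIter_four_one {J : ℕ} {c : ℕ → ℝ} (hc : ∀ n, 1 ≤ n → 0 ≤ c n) {b : ℕ}
    (hb : 1 ≤ b) (m : ℕ) :
    coeffNorm (cutoffIter 4 J b m) (upperCoeffIter 4 J c b 1 m) = mkIterFun b m (plaqFn J c) 1 - 1 := by
  rw [coeffNorm_eq_plaqFn_one_sub_one, mkIterFun_plaqFn hc hb m]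

/-- **(H_flow) at `r = 1`, `d = 4` follows from convergence of the iterates at the identity**: if
`f_c^{(m)}(𝟙) → 1` then `‖g^U(m)‖ → 0`. [cite: Tomboulis2007Confinement, §3.4 eq. (3.43)] -/
theorem upperFlowInNorm_four_one_of_tendsto {J : ℕ} {c : ℕ → ℝ} (hc : ∀ n, 1 ≤ n → 0 ≤ c n) {b : ℕ}
    (hb : 1 ≤ b) (h : Tendsto (fun m => mkIterFun b m (plaqFn J c) 1) atTop (𝓝 1)) :
    UpperFlowInNorm 4 J c b 1 := by
  unfold UpperFlowInNorm
  have h2 := h.sub_const 1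
  rw [sub_self] at h2
  refine h2.congr fun m => ?_
  rw [coeffNorm_upperCoeffIter_four_one hc hb m]

/-! ### §9 Ito's curvature argument for an ARBITRARY positive `C²` class datum (CMP 110 (1987) §3, verbatim) -/

/-- Normalising by a positive constant preserves the fibre data and the curvature bound (plumbing). [folklore] -/
private theorem normalise_curv_spec {F F₁ F₂ : SU2 → ℝ} {Z B : ℝ} (hZ : 0 < Z)
    (hFc : ∀ u v : SU2, F (v * u * v⁻¹) = F u) (hF : Continuous F) (hF₁ : Continuous F₁)
    (hF₂ : Continuous F₂) (hpos : ∀ u, 0 < F u)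
    (hdF : ∀ (g : SU2) (s : ℝ), HasDerivAt (fun t => F (diagPhase t * g)) (F₁ (diagPhase s * g)) s)
    (hdF' : ∀ (g : SU2) (s : ℝ), HasDerivAt (fun t => F₁ (diagPhase t * g)) (F₂ (diagPhase s * g)) s)
    (hc : ∀ u, F₁ u ^ 2 - F₂ u * F u ≤ B * F u ^ 2) :
    (∀ u v : SU2, F (v * u * v⁻¹) / Z = F u / Z) ∧ Continuous (fun u => F u / Z) ∧
      Continuous (fun u => F₁ u / Z) ∧ Continuous (fun u => F₂ u / Z) ∧ (∀ u, 0 < F u / Z) ∧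
      (∀ (g : SU2) (s : ℝ), HasDerivAt (fun t => F (diagPhase t * g) / Z) (F₁ (diagPhase s * g) / Z) s) ∧
      (∀ (g : SU2) (s : ℝ), HasDerivAt (fun t => F₁ (diagPhase t * g) / Z) (F₂ (diagPhase s * g) / Z) s) ∧
      ∀ u, (F₁ u / Z) ^ 2 - F₂ u / Z * (F u / Z) ≤ B * (F u / Z) ^ 2 := by
  refine ⟨fun u v => by rw [hFc], hF.div_const _, hF₁.div_const _, hF₂.div_const _,
    fun u => div_pos (hpos u) hZ, fun g s => (hdF g s).div_const Z, fun g s => (hdF' g s).div_const Z,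
    fun u => ?_⟩
  have h := div_le_div_of_nonneg_right (hc u) (sq_nonneg Z)
  have hZ2 : Z ^ 2 ≠ 0 := pow_ne_zero 2 hZ.ne'
  calc (F₁ u / Z) ^ 2 - F₂ u / Z * (F u / Z) = (F₁ u ^ 2 - F₂ u * F u) / Z ^ 2 := by
        field_simp
    _ ≤ B * F u ^ 2 / Z ^ 2 := h
    _ = B * (F u / Z) ^ 2 := by field_simp

/-- **Ito's invariant along the iteration for an arbitrary datum** (CMP 110 §3 Thm. 4 (1), eqs. (22)–(23),
quantified): if `f` is a positive normalised (`∫ f = 1`) class function on `SU(2)`, `C²` along the `σ₃`-fibres with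
local curvature `≤ B₀` (`B₀ ≥ 0`), then its `n`-th `D = 4` Migdal–Kadanoff iterate (scale factor `b ≥ 2`) is a
positive normalised class function, `C²` along the fibres, with curvature `≤ B_n ≤ B₀ qⁿ`,
`q = 1 - ½ e^{-b⁴B₀π²/2} < 1` (Ito states the recursion for the Heisenberg/Wilson datum; the proof uses only these
properties of the datum — TODO(general form): `SU(N)`, `D ≤ 3`).
[cite: Ito1987HierarchicalHeisenberg, §3 Thm. 4 (1), eqs. (22)–(23)] -/
theorem mkIterFun_spec_of_curv {f f₁ f₂ : SU2 → ℝ} (hfc : ∀ u v : SU2, f (v * u * v⁻¹) = f u)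
    (hf : Continuous f) (hf₁ : Continuous f₁) (hf₂ : Continuous f₂) (hpos : ∀ u, 0 < f u)
    (hdf : ∀ (g : SU2) (s : ℝ), HasDerivAt (fun t => f (diagPhase t * g)) (f₁ (diagPhase s * g)) s)
    (hdf' : ∀ (g : SU2) (s : ℝ), HasDerivAt (fun t => f₁ (diagPhase t * g)) (f₂ (diagPhase s * g)) s)
    {B₀ : ℝ} (hB₀ : 0 ≤ B₀) (hcurv : ∀ u, f₁ u ^ 2 - f₂ u * f u ≤ B₀ * f u ^ 2)
    (hint : ∫ u, f u ∂(haarProbability SU2) = 1) {b : ℕ} (hb : 2 ≤ b) (n : ℕ) :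
    ∃ (B : ℝ) (F₁ F₂ : SU2 → ℝ), 0 ≤ B ∧
      B ≤ B₀ * (1 - Real.exp (-(((b : ℝ) ^ 2) ^ 2 * (B₀ * π ^ 2 / 2))) / 2) ^ n ∧
      (∀ u v : SU2, mkIterFun b n f (v * u * v⁻¹) = mkIterFun b n f u) ∧
      Continuous (mkIterFun b n f) ∧ Continuous F₁ ∧ Continuous F₂ ∧
      (∀ u, 0 < mkIterFun b n f u) ∧
      (∀ (g : SU2) (s : ℝ), HasDerivAt (fun t => mkIterFun b n f (diagPhase t * g))
        (F₁ (diagPhase s * g)) s) ∧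
      (∀ (g : SU2) (s : ℝ), HasDerivAt (fun t => F₁ (diagPhase t * g)) (F₂ (diagPhase s * g)) s) ∧
      (∀ u, F₁ u ^ 2 - F₂ u * mkIterFun b n f u ≤ B * mkIterFun b n f u ^ 2) ∧
      ∫ u, mkIterFun b n f u ∂(haarProbability SU2) = 1 := by
  -- the exponent `b² = k + 2`
  obtain ⟨k, hk⟩ : ∃ k : ℕ, b ^ 2 = k + 2 :=
    ⟨b ^ 2 - 2, by have := Nat.pow_le_pow_left hb 2; omega⟩
  have hk1 : k + 2 - 1 = k + 1 := rfl
  have hkR : ((k : ℝ) + 2) = (b : ℝ) ^ 2 := by exact_mod_cast hk.symm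
  set q : ℝ := 1 - Real.exp (-(((b : ℝ) ^ 2) ^ 2 * (B₀ * π ^ 2 / 2))) / 2 with hqdef
  induction n with
  | zero =>
    refine ⟨B₀, f₁, f₂, hB₀, by simp, ?_, ?_, hf₁, hf₂, ?_, ?_, hdf', ?_, ?_⟩
    · rw [mkIterFun_zero]; exact hfc
    · rw [mkIterFun_zero]; exact hf
    · rw [mkIterFun_zero]; exact hpos
    · rw [mkIterFun_zero]; exact hdf
    · rw [mkIterFun_zero]; exact hcurv
    · rw [mkIterFun_zero]; exact hint
  | succ n ih =>
    obtain ⟨B, g₁, g₂, hB, hBle, hgc, hg, hg₁, hg₂, hgpos, hdg, hdg', hc, -⟩ := ih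
    set g := mkIterFun b n f with hgdef
    obtain ⟨F₁, F₂, hFc, hF, hF₁, hF₂, hFpos, hdF, hdF', hcF⟩ :=
      ItoSU2.mkStep_spec k hgc hg hg₁ hg₂ hgpos hdg hdg' hB hc
    set F := convPow (fun V => g V ^ (k + 2)) (k + 1) with hFdef
    set Z : ℝ := ∫ V, F V ∂(haarProbability SU2) with hZdef
    have hZ : 0 < Z := by
      obtain ⟨m, hm⟩ : ∃ m, 0 < m ∧ ∀ u, m ≤ F u := by
        obtain ⟨u₀, -, hu₀⟩ := isCompact_univ.exists_isMinOn univ_nonempty hF.continuousOn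
        exact ⟨_, hFpos u₀, fun u => hu₀ (mem_univ u)⟩
      calc (0 : ℝ) < m := hm.1
        _ = ∫ V, m ∂(haarProbability SU2) := by simp
        _ ≤ Z := integral_mono (integrable_const _) (integrable_of_continuous₃ hF) hm.2
    set B' : ℝ := B * (1 - Real.exp (-(((k : ℝ) + 2) ^ 2 * (B * π ^ 2 / 2))) / 2) with hB'def
    obtain ⟨h1, h2, h3, h4, h5, h6, h7, h8⟩ := normalise_curv_spec hZ hFc hF hF₁ hF₂ hFpos hdF hdF' hcF
    have hstep : mkIterFun b (n + 1) f = fun u => F u / Z := by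
      rw [mkIterFun_succ, ← hgdef]
      funext u
      simp only [mkStepFun, hk, hk1, hFdef, hZdef]
    have hB'0 : 0 ≤ B' := by
      have : Real.exp (-(((k : ℝ) + 2) ^ 2 * (B * π ^ 2 / 2))) ≤ 1 :=
        Real.exp_le_one_iff.mpr (by
          have : 0 ≤ ((k : ℝ) + 2) ^ 2 * (B * π ^ 2 / 2) := by positivity
          linarith)
      have : 0 ≤ 1 - Real.exp (-(((k : ℝ) + 2) ^ 2 * (B * π ^ 2 / 2))) / 2 := by linarith
      exact mul_nonneg hB this
    have hq0 : 0 ≤ q := by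
      have : Real.exp (-(((b : ℝ) ^ 2) ^ 2 * (B₀ * π ^ 2 / 2))) ≤ 1 :=
        Real.exp_le_one_iff.mpr (by
          have : 0 ≤ ((b : ℝ) ^ 2) ^ 2 * (B₀ * π ^ 2 / 2) := by positivity
          linarith)
      rw [hqdef]; linarith
    have hBB0 : B ≤ B₀ := by
      refine hBle.trans ?_
      have hq1 : q ≤ 1 := by
        rw [hqdef]; linarith [Real.exp_pos (-(((b : ℝ) ^ 2) ^ 2 * (B₀ * π ^ 2 / 2)))]
      have := pow_le_one₀ hq0 hq1 (n := n)
      nlinarith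
    have hB'le : B' ≤ B₀ * q ^ (n + 1) := by
      -- `B' = B (1 - ½ e^{-b⁴Bπ²/2}) ≤ B (1 - ½ e^{-b⁴B₀π²/2}) = B q ≤ B₀ qⁿ q`
      have hexp : Real.exp (-(((b : ℝ) ^ 2) ^ 2 * (B₀ * π ^ 2 / 2))) ≤
          Real.exp (-(((k : ℝ) + 2) ^ 2 * (B * π ^ 2 / 2))) := by
        rw [Real.exp_le_exp, hkR, neg_le_neg_iff]
        have : 0 ≤ ((b : ℝ) ^ 2) ^ 2 * (π ^ 2 / 2) := by positivity
        nlinarith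
      have h1' : B' ≤ B * q := by
        rw [hB'def, hqdef]
        refine mul_le_mul_of_nonneg_left ?_ hB
        linarith
      calc B' ≤ B * q := h1'
        _ ≤ B₀ * q ^ n * q := mul_le_mul_of_nonneg_right hBle hq0
        _ = B₀ * q ^ (n + 1) := by ring
    refine ⟨B', _, _, hB'0, hB'le, ?_, ?_, h3, h4, ?_, ?_, h7, ?_, ?_⟩
    · rw [hstep]; exact h1
    · rw [hstep]; exact h2
    · rw [hstep]; exact h5
    · rw [hstep]; exact h6
    · rw [hstep]; exact h8
    · rw [hstep]
      show (∫ u, F u / Z ∂(haarProbability SU2)) = 1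
      rw [integral_div, div_self hZ.ne']

/-- **Ito's Theorem 4 (2) for an arbitrary positive `C²` class datum** (`SU(2)`, `D = 4`, `r = 1`, every `b ≥ 2`):
the Migdal–Kadanoff iterates converge UNIFORMLY to the strong-coupling fixed point `f ≡ 1`,
`sup|f^{(n)} - 1| ≤ e^{B_nπ²/2} - 1`, `B_n ≤ B₀qⁿ` («`lim g⁽ⁿ⁾(v) = 1`, uniformly in `v`»; Ito (24) with `∫ f⁽ⁿ⁾ = 1`).
The tree's `mkIterFun_tendstoUniformly_one` is the instance `f = ` Wilson's datum, `B₀ = 2β`.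
[cite: Ito1987HierarchicalHeisenberg, §3 Thm. 4 (2), eq. (24)] -/
theorem mkIterFun_tendstoUniformly_one_of_curv {f f₁ f₂ : SU2 → ℝ}
    (hfc : ∀ u v : SU2, f (v * u * v⁻¹) = f u)
    (hf : Continuous f) (hf₁ : Continuous f₁) (hf₂ : Continuous f₂) (hpos : ∀ u, 0 < f u)
    (hdf : ∀ (g : SU2) (s : ℝ), HasDerivAt (fun t => f (diagPhase t * g)) (f₁ (diagPhase s * g)) s)
    (hdf' : ∀ (g : SU2) (s : ℝ), HasDerivAt (fun t => f₁ (diagPhase t * g)) (f₂ (diagPhase s * g)) s)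
    {B₀ : ℝ} (hB₀ : 0 ≤ B₀) (hcurv : ∀ u, f₁ u ^ 2 - f₂ u * f u ≤ B₀ * f u ^ 2)
    (hint : ∫ u, f u ∂(haarProbability SU2) = 1) {b : ℕ} (hb : 2 ≤ b) :
    TendstoUniformly (fun n => mkIterFun b n f) (fun _ => 1) atTop := by
  set q : ℝ := 1 - Real.exp (-(((b : ℝ) ^ 2) ^ 2 * (B₀ * π ^ 2 / 2))) / 2 with hqdef
  have hq0 : 0 ≤ q := by
    have : Real.exp (-(((b : ℝ) ^ 2) ^ 2 * (B₀ * π ^ 2 / 2))) ≤ 1 :=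
      Real.exp_le_one_iff.mpr (by
        have : 0 ≤ ((b : ℝ) ^ 2) ^ 2 * (B₀ * π ^ 2 / 2) := by positivity
        linarith)
    rw [hqdef]; linarith
  have hq1 : q < 1 := by
    rw [hqdef]; linarith [Real.exp_pos (-(((b : ℝ) ^ 2) ^ 2 * (B₀ * π ^ 2 / 2)))]
  -- the uniform bound `|f⁽ⁿ⁾ - 1| ≤ exp(B₀ qⁿ π²/2) - 1`
  have hbound : ∀ n (U : SU2), |mkIterFun b n f U - 1| ≤ Real.exp (B₀ * q ^ n * π ^ 2 / 2) - 1 := by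
    intro n U
    obtain ⟨B, g₁, g₂, hB, hBle, hgc, hg, -, hg₂, hgpos, hdg, hdg', hc, hgint⟩ :=
      mkIterFun_spec_of_curv hfc hf hf₁ hf₂ hpos hdf hdf' hB₀ hcurv hint hb n
    obtain ⟨M, hM0, hle, hge⟩ := ItoSU2.exists_bounds_of_curv hgc hg₂ hgpos hdg hdg' hB hc
    set g := mkIterFun b n f with hgdef
    set r : ℝ := Real.exp (-(B * π ^ 2 / 2)) with hrdef
    have hr0 : 0 < r := Real.exp_pos _
    have hgint' : Integrable g (haarProbability SU2) := integrable_of_continuous₃ hg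
    have hM1 : 1 ≤ M := by
      rw [← hgint]
      calc ∫ u, g u ∂(haarProbability SU2) ≤ ∫ u, M ∂(haarProbability SU2) :=
            integral_mono hgint' (integrable_const _) hle
        _ = M := by simp
    have hMr : M * r ≤ 1 := by
      rw [← hgint]
      calc M * r = ∫ u, M * r ∂(haarProbability SU2) := by simp
        _ ≤ ∫ u, g u ∂(haarProbability SU2) := integral_mono (integrable_const _) hgint' hge
    have hrexp : Real.exp (B * π ^ 2 / 2) ≤ Real.exp (B₀ * q ^ n * π ^ 2 / 2) := by
      rw [Real.exp_le_exp]
      nlinarith [Real.pi_pos, sq_nonneg π]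
    have hrinv : r⁻¹ = Real.exp (B * π ^ 2 / 2) := by rw [hrdef, ← Real.exp_neg, neg_neg]
    have hM' : M ≤ r⁻¹ := by
      have h := (le_div_iff₀ hr0).mpr hMr
      rwa [one_div] at h
    have hr1 : r ≤ 1 := by
      rw [hrdef]
      exact Real.exp_le_one_iff.mpr (neg_nonpos.mpr (by positivity))
    have hinv : r⁻¹ * r = 1 := inv_mul_cancel₀ hr0.ne'
    rw [abs_le]
    constructor
    · have h1 : M * r ≤ g U := hge U
      have h2 : M - M * r ≤ r⁻¹ - 1 := by
        nlinarith [mul_le_mul_of_nonneg_right hM' (sub_nonneg.2 hr1)]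
      linarith
    · have h1 : g U ≤ M := hle U
      linarith
  rw [Metric.tendstoUniformly_iff]
  intro ε hε
  have hlim : Tendsto (fun n : ℕ => Real.exp (B₀ * q ^ n * π ^ 2 / 2) - 1) atTop (𝓝 0) := by
    have hq := tendsto_pow_atTop_nhds_zero_of_lt_one hq0 hq1
    have h1 : Tendsto (fun n : ℕ => B₀ * q ^ n * π ^ 2 / 2) atTop (𝓝 (B₀ * 0 * π ^ 2 / 2)) :=
      ((hq.const_mul B₀).mul_const (π ^ 2)).div_const 2
    have h2 := ((Real.continuous_exp.tendsto _).comp h1).sub_const 1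
    simpa using h2
  filter_upwards [(tendsto_order.1 hlim).2 ε hε] with n hn U
  rw [Real.dist_eq, abs_sub_comm]
  exact (hbound n U).trans_lt hn

/-! ### §10 A positive truncated plaquette function is an Ito datum; (H_flow) at `r = 1`, `d = 4`; the chain -/

/-- `∂_t u₀(e^{-itσ₃} g) = u₃(e^{-itσ₃} g)` (plumbing). [folklore] -/
private theorem hasDerivAt_u0_fibre' (g : SU2) (s : ℝ) :
    HasDerivAt (fun t => u0 (diagPhase t * g)) (u3 (diagPhase s * g)) s := by
  have hfun : (fun t => u0 (diagPhase t * g)) = fun t => u0 g * Real.cos t + u3 g * Real.sin t :=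
    funext fun t => u0_diagPhase_mul t g
  rw [hfun, u3_diagPhase_mul]
  have h := ((Real.hasDerivAt_cos s).const_mul (u0 g)).add ((Real.hasDerivAt_sin s).const_mul (u3 g))
  refine h.congr_deriv ?_
  ring

/-- `∂_t u₃(e^{-itσ₃} g) = -u₀(e^{-itσ₃} g)` (plumbing). [folklore] -/
private theorem hasDerivAt_u3_fibre' (g : SU2) (s : ℝ) :
    HasDerivAt (fun t => u3 (diagPhase t * g)) (-u0 (diagPhase s * g)) s := by
  have hfun : (fun t => u3 (diagPhase t * g)) = fun t => u3 g * Real.cos t - u0 g * Real.sin t :=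
    funext fun t => u3_diagPhase_mul t g
  rw [hfun, u0_diagPhase_mul]
  have h := ((Real.hasDerivAt_cos s).const_mul (u3 g)).sub ((Real.hasDerivAt_sin s).const_mul (u0 g))
  refine h.congr_deriv ?_
  ring

/-- The plaquette function is a polynomial in `u₀ = Re tr/2` (plumbing: `f_c = P_c(u₀)`,
`P_c = 1 + Σ d_j c_j U_{2j}`). [folklore] -/
private theorem plaqFn_eq_eval_u0 (J : ℕ) (c : ℕ → ℝ) (U : SU2) :
    plaqFn J c U = (Polynomial.C 1 + ∑ n ∈ Icc 1 J,
      Polynomial.C (((n : ℝ) + 1) * c n) * Polynomial.Chebyshev.U ℝ (n : ℤ)).eval (u0 U) := by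
  unfold plaqFn
  rw [Polynomial.eval_add, Polynomial.eval_C, Polynomial.eval_finsetSum]
  refine congrArg (fun x => (1 : ℝ) + x) (Finset.sum_congr rfl fun n _ => ?_)
  rw [Polynomial.eval_mul, Polynomial.eval_C, ItoSU2.su2Char_eq_eval_u0]

/-- **A positive plaquette function is an Ito datum**: a class function, `C²` along the `σ₃`-fibres
(`f₁ = P'(u₀)u₃`, `f₂ = P''(u₀)u₃² - P'(u₀)u₀`), with bounded local curvature (by compactness of `SU(2)`).
[cite: Ito1987HierarchicalHeisenberg, §3 eq. (13) and Remark 1 p. 241 (class functions of G)] -/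
theorem plaqFn_itoDatum {J : ℕ} {c : ℕ → ℝ} (hf : ∀ U : SU2, 0 < plaqFn J c U) :
    ∃ (f₁ f₂ : SU2 → ℝ) (B₀ : ℝ), 0 ≤ B₀ ∧
      (∀ u v : SU2, plaqFn J c (v * u * v⁻¹) = plaqFn J c u) ∧ Continuous (plaqFn J c) ∧
      Continuous f₁ ∧ Continuous f₂ ∧
      (∀ (g : SU2) (s : ℝ), HasDerivAt (fun t => plaqFn J c (diagPhase t * g)) (f₁ (diagPhase s * g)) s) ∧
      (∀ (g : SU2) (s : ℝ), HasDerivAt (fun t => f₁ (diagPhase t * g)) (f₂ (diagPhase s * g)) s) ∧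
      ∀ u, f₁ u ^ 2 - f₂ u * plaqFn J c u ≤ B₀ * plaqFn J c u ^ 2 := by
  set P : Polynomial ℝ := Polynomial.C 1 + ∑ n ∈ Icc 1 J,
      Polynomial.C (((n : ℝ) + 1) * c n) * Polynomial.Chebyshev.U ℝ (n : ℤ) with hPdef
  set P₁ := Polynomial.derivative P with hP₁
  set P₂ := Polynomial.derivative P₁ with hP₂
  have hP : ∀ U, plaqFn J c U = P.eval (u0 U) := fun U => plaqFn_eq_eval_u0 J c U
  have hPf : plaqFn J c = fun U => P.eval (u0 U) := funext hP
  set f₁ : SU2 → ℝ := fun U => P₁.eval (u0 U) * u3 U with hf₁def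
  set f₂ : SU2 → ℝ := fun U => P₂.eval (u0 U) * u3 U ^ 2 - P₁.eval (u0 U) * u0 U with hf₂def
  have cP : ∀ p : Polynomial ℝ, Continuous fun U : SU2 => p.eval (u0 U) := fun p =>
    (Polynomial.continuous _).comp continuous_u0
  have hfC : Continuous (plaqFn J c) := by rw [hPf]; exact cP P
  have hf₁C : Continuous f₁ := (cP P₁).mul continuous_u3
  have hf₂C : Continuous f₂ := ((cP P₂).mul (continuous_u3.pow 2)).sub ((cP P₁).mul continuous_u0)
  have hd1 : ∀ (g : SU2) (s : ℝ), HasDerivAt (fun t => plaqFn J c (diagPhase t * g)) (f₁ (diagPhase s * g)) s := by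
    intro g s
    rw [hPf]
    exact (Polynomial.hasDerivAt P (u0 (diagPhase s * g))).comp s (hasDerivAt_u0_fibre' g s)
  have hd2 : ∀ (g : SU2) (s : ℝ), HasDerivAt (fun t => f₁ (diagPhase t * g)) (f₂ (diagPhase s * g)) s := by
    intro g s
    have h := ((Polynomial.hasDerivAt P₁ (u0 (diagPhase s * g))).comp s (hasDerivAt_u0_fibre' g s)).mul
      (hasDerivAt_u3_fibre' g s)
    refine h.congr_deriv ?_
    simp only [hf₂def, hP₂, Function.comp_apply]
    ring
  -- curvature bound by compactness
  set κ : SU2 → ℝ := fun u => (f₁ u ^ 2 - f₂ u * plaqFn J c u) / plaqFn J c u ^ 2 with hκdef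
  have hκC : Continuous κ :=
    ((hf₁C.pow 2).sub (hf₂C.mul hfC)).div (hfC.pow 2) fun u => pow_ne_zero 2 (hf u).ne'
  obtain ⟨u₀, -, hu₀⟩ := isCompact_univ.exists_isMaxOn univ_nonempty hκC.continuousOn
  refine ⟨f₁, f₂, max (κ u₀) 0, le_max_right _ _, fun u v => by rw [hP, hP, u0_conj], hfC, hf₁C, hf₂C,
    hd1, hd2, fun u => ?_⟩
  have hκu : κ u ≤ max (κ u₀) 0 := (hu₀ (mem_univ u)).trans (le_max_left _ _)
  have hpos2 : 0 < plaqFn J c u ^ 2 := pow_pos (hf u) 2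
  have hid : κ u * plaqFn J c u ^ 2 = f₁ u ^ 2 - f₂ u * plaqFn J c u := by
    simp only [hκdef]
    exact div_mul_cancel₀ _ hpos2.ne'
  rw [← hid]
  exact mul_le_mul_of_nonneg_right hκu hpos2.le

/-- **Ito's uniform flow for every positive truncated plaquette function** (`SU(2)`, `D = 4`, `r = 1`, `b ≥ 2`):
`f_c^{(n)} → 1` uniformly on `SU(2)`. [cite: Ito1987HierarchicalHeisenberg, §3 Thm. 4 (2)]
[cite: ItoSeiler2007Tomboulis, §2 Thm. 2.1] -/
theorem mkIterFun_plaqFn_tendstoUniformly_one {J : ℕ} {c : ℕ → ℝ} (hf : ∀ U : SU2, 0 < plaqFn J c U)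
    {b : ℕ} (hb : 2 ≤ b) :
    TendstoUniformly (fun n => mkIterFun b n (plaqFn J c)) (fun _ => 1) atTop := by
  obtain ⟨f₁, f₂, B₀, hB₀, hfc, hfC, hf₁, hf₂, hdf, hdf', hcurv⟩ := plaqFn_itoDatum hf
  exact mkIterFun_tendstoUniformly_one_of_curv hfc hfC hf₁ hf₂ hf hdf hdf' hB₀ hcurv (integral_plaqFn J c) hb

/-- **(H_flow) at `r = 1`, `d = 4` is a THEOREM**: for `c_j ≥ 0` with `f_c > 0` and every integer `b ≥ 2` the
upper-bound (= standard MK) column of scheme (3.38) flows to strong coupling in the norm (2.11), `‖g^U(m)‖ → 0`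
(arXiv:0707.2179 (3.43): "as it is well-known, the MK decimations for SU(2) … flow to strong coupling"; here by
Ito's theorem on the functional recursion and the identification of §8). [cite: Tomboulis2007Confinement, §3.4 eq. (3.43)]
[cite: ItoSeiler2007Tomboulis, §2 Thm. 2.1] [cite: Ito1987HierarchicalHeisenberg, §3 Thm. 4] -/
theorem upperFlowInNorm_four_one {J : ℕ} {c : ℕ → ℝ} (hc : ∀ n, 1 ≤ n → 0 ≤ c n)
    (hf : ∀ U : SU2, 0 < plaqFn J c U) {b : ℕ} (hb : 2 ≤ b) : UpperFlowInNorm 4 J c b 1 :=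
  upperFlowInNorm_four_one_of_tendsto hc (le_trans (by norm_num) hb)
    ((mkIterFun_plaqFn_tendstoUniformly_one hf hb).tendsto_at 1)

/-- **«(5.16) ⟹ confinement» at `r = 1` in `d = 4` with ONLY THE DISPUTED PREMISES LEFT.**  For initial
coefficients `0 ≤ c_j ≤ 1` (2.8) with POSITIVE plaquette function `f_c > 0` and every integer `b ≥ 2`: IF (H_sc) `d = 4`
has a strong-coupling regime for the twist (§6.2; a published theorem not yet typed), (H_C) Appendix C's
matching/common-`t*` claim (Ito–Seiler's Problems 1–2) and (H_516) the disputed inequality (5.16) hold at every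
level, coarse side and plane, THEN every plane has a level `n` with the electric-flux area law along the sides
`b^n L`.  (H_flow) is Ito's theorem (§9–§10 above); (H_pos), (H_V1), (H_V2) and plaquette positivity are theorems
of Part I / `TomboulisChainTelescoping`. [cite: Tomboulis2007Confinement, Abstract, §3.4 eq. (3.43), §5 Props. V.1–V.2, §6.2, App. C]
[cite: ItoSeiler2009Critical, §§2, 4(b), 5] -/
theorem electricFluxAreaLawAlong_of_chain_four (J : ℕ) (c : ℕ → ℝ) (b : ℕ) [NeZero b] (hb : 2 ≤ b)
    (hc : CoeffAdmissible c) (hf : ∀ U : SU2, 0 < plaqFn J c U) (hSC : StrongCouplingRegime 4)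
    (hC : ∀ (n L : ℕ) [NeZero L] (i j : Fin 4) (hij : i < j), 1 ≤ n → 2 ≤ L → AppendixCClaim 4 L b J n 1 hij c)
    (h516 : ∀ (n L : ℕ) [NeZero L] (i j : Fin 4) (hij : i < j), 1 ≤ n → 2 ≤ L →
      Ineq516AtLevel 4 L b J n 1 hij c) :
    ∀ (i j : Fin 4) (hij : i < j), ∃ n : ℕ, ElectricFluxAreaLawAlong 4 b n J c hij :=
  electricFluxAreaLawAlong_of_chain_one 4 J c b hc (fun U => (hf U).le)
    (upperFlowInNorm_four_one (fun n hn => (hc n hn).1) hf hb) hSC hC h516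

/-! ### §11 Tomboulis's (3.43) at `r = 1` ⟺ Ito's uniform flow; Ito–Seiler's Thm 2.1 for positive truncated data -/

/-- `|χ_j| ≤ d_j` on `SU(2)` (`|U_n| ≤ n + 1` on `[-1, 1]`; plumbing). [folklore] -/
private theorem abs_su2Char_le₃ (n : ℕ) (U : SU2) : |su2Char n U| ≤ (n : ℝ) + 1 := by
  rw [ItoSU2.su2Char_eq_eval_u0]
  exact Literature.Analysis.SpecialFunctions.abs_chebyshevU_eval_le n (abs_u0_le_one U)

/-- **`sup |f_c - 1| ≤ ‖g‖`** for `c_j ≥ 0`: the norm (2.11) majorises the deviation `g_p = f_p - 1` (2.10) pointwise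
(`|χ_j| ≤ d_j`). [cite: Tomboulis2007Confinement, §2 eqs. (2.10)–(2.11)] -/
theorem abs_plaqFn_sub_one_le_coeffNorm {J : ℕ} {c : ℕ → ℝ} (hc : ∀ n, 1 ≤ n → 0 ≤ c n) (U : SU2) :
    |plaqFn J c U - 1| ≤ coeffNorm J c := by
  unfold plaqFn coeffNorm
  rw [add_sub_cancel_left]
  refine (Finset.abs_sum_le_sum_abs _ _).trans (Finset.sum_le_sum fun k hk => ?_)
  have hk1 : 1 ≤ k := (Finset.mem_Icc.mp hk).1
  have hck : 0 ≤ c k := hc k hk1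
  rw [abs_mul, abs_mul, abs_of_nonneg (by positivity : (0 : ℝ) ≤ (k : ℝ) + 1), abs_of_nonneg hck]
  calc ((k : ℝ) + 1) * c k * |su2Char k U| ≤ ((k : ℝ) + 1) * c k * ((k : ℝ) + 1) :=
        mul_le_mul_of_nonneg_left (abs_su2Char_le₃ k U) (by positivity)
    _ = ((k : ℝ) + 1) ^ 2 * c k := by ring

/-- The norm (2.11) is non-negative on the standing domain `c_j ≥ 0` (plumbing). [folklore] -/
private theorem coeffNorm_nonneg' {J : ℕ} {c : ℕ → ℝ} (hc : ∀ n, 1 ≤ n → 0 ≤ c n) : 0 ≤ coeffNorm J c :=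
  Finset.sum_nonneg fun k hk => mul_nonneg (sq_nonneg _) (hc k (Finset.mem_Icc.mp hk).1)

/-- **Tomboulis's norm flow (3.43) at `r = 1`, `d = 4`, is EQUIVALENT to Ito's uniform flow of the functional
iterates** `f_c^{(m)} → 1` (for `c_j ≥ 0`, `b ≥ 1`): `‖g^U(m)‖ = f^{(m)}(𝟙) - 1 ≥ sup|f^{(m)} - 1|`.
[cite: Tomboulis2007Confinement, §3.4 eq. (3.43)] [cite: Ito1987HierarchicalHeisenberg, §3 Thm. 4 (2)] -/
theorem upperFlowInNorm_four_one_iff_tendstoUniformly {J : ℕ} {c : ℕ → ℝ} (hc : ∀ n, 1 ≤ n → 0 ≤ c n)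
    {b : ℕ} (hb : 1 ≤ b) :
    UpperFlowInNorm 4 J c b 1 ↔ TendstoUniformly (fun m => mkIterFun b m (plaqFn J c)) (fun _ => 1) atTop := by
  constructor
  · intro h
    rw [Metric.tendstoUniformly_iff]
    intro ε hε
    unfold UpperFlowInNorm at h
    filter_upwards [(tendsto_order.1 h).2 ε hε] with m hm U
    rw [Real.dist_eq, abs_sub_comm, mkIterFun_plaqFn hc hb m]
    exact (abs_plaqFn_sub_one_le_coeffNorm (upperCoeffIter_nonneg (d := 4) (J := J) hc b 1 m) U).trans_lt hm
  · intro h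
    exact upperFlowInNorm_four_one_of_tendsto hc hb (h.tendsto_at 1)

/-- **Character coefficients of a plaquette function**: `c_0 = 1`, `c_j` for `1 ≤ 2j ≤ J`, `0` beyond the cut-off
(character orthonormality). [cite: ItoSeiler2007Tomboulis, §2 eqs. (2.1b), (2.3)] -/
theorem charCoeff_plaqFn (J : ℕ) (c : ℕ → ℝ) (j : ℕ) :
    charCoeff (plaqFn J c) j = if j = 0 then 1 else if j ≤ J then c j else 0 := by
  unfold charCoeff
  simp_rw [plaqFn_eq_charSum J c, Finset.sum_mul]
  have hint : ∀ m : ℕ, Integrable (fun U : SU2 =>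
      (if m = 0 then (1 : ℝ) else ((m : ℝ) + 1) * c m) * su2Char m U * (su2Char j U / ((j : ℝ) + 1)))
      (haarProbability SU2) := fun m =>
    integrable_of_continuous₃ ((continuous_const.mul (continuous_su2Char₃ m)).mul
      ((continuous_su2Char₃ j).div_const _))
  rw [integral_finsetSum _ (fun m _ => hint m)]
  have hterm : ∀ m : ℕ, ∫ U, (if m = 0 then (1 : ℝ) else ((m : ℝ) + 1) * c m) * su2Char m U *
      (su2Char j U / ((j : ℝ) + 1)) ∂(haarProbability SU2) =
      (if m = 0 then (1 : ℝ) else ((m : ℝ) + 1) * c m) / ((j : ℝ) + 1) * (if m = j then 1 else 0) := by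
    intro m
    rw [← integral_su2Char_mul_su2Char m j, ← integral_const_mul]
    refine integral_congr_ae (Filter.Eventually.of_forall fun U => ?_)
    simp only
    ring
  simp_rw [hterm, mul_ite, mul_one, mul_zero]
  rw [Finset.sum_ite_eq' (Finset.range (J + 1)) j]
  have hj1 : ((j : ℝ) + 1) ≠ 0 := by positivity
  by_cases hj0 : j = 0
  · subst hj0; simp
  · simp only [if_neg hj0]
    by_cases hjJ : j ≤ J
    · rw [if_pos (Finset.mem_range.mpr (Nat.lt_succ_of_le hjJ)), if_pos hjJ]
      field_simp
    · rw [if_neg (fun h => hjJ (Nat.le_of_lt_succ (Finset.mem_range.mp h))), if_neg hjJ]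

/-- **Ito–Seiler's Theorem 2.1 for every positive truncated datum** (`SU(2)`, `D = 4`, `r = 1`, every `b ≥ 2`): the
character coefficients of the Migdal–Kadanoff iterates of `f_c` (`0 ≤ c_j`, `f_c > 0`) tend to zero,
`c_j(n) → 0` for every `j ≠ 0` — `MKFlowToStrongCoupling b f_c` (the tree's `itoTheoremSU2_holds` is the untruncated
Wilson datum). [cite: ItoSeiler2007Tomboulis, §2 Thm. 2.1] [cite: Ito1987HierarchicalHeisenberg, §3 Thm. 4] -/
theorem mkFlowToStrongCoupling_plaqFn {J : ℕ} {c : ℕ → ℝ} (hc : ∀ n, 1 ≤ n → 0 ≤ c n)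
    (hf : ∀ U : SU2, 0 < plaqFn J c U) {b : ℕ} (hb : 2 ≤ b) : MKFlowToStrongCoupling b (plaqFn J c) := by
  intro j hj
  have hb1 : 1 ≤ b := le_trans (by norm_num) hb
  have hflow : Tendsto (fun m => coeffNorm (cutoffIter 4 J b m) (upperCoeffIter 4 J c b 1 m)) atTop (𝓝 0) :=
    upperFlowInNorm_four_one hc hf hb
  refine squeeze_zero_norm (fun n => ?_) hflow
  have hcn := upperCoeffIter_nonneg (d := 4) (J := J) hc b 1 n
  have hj1 : 1 ≤ j := Nat.one_le_iff_ne_zero.mpr hj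
  rw [Real.norm_eq_abs, mkIterFun_plaqFn hc hb1 n, charCoeff_plaqFn, if_neg hj]
  split_ifs with hjJ
  · rw [abs_of_nonneg (hcn j hj1)]
    unfold coeffNorm
    refine le_trans ?_ (Finset.single_le_sum (f := fun k : ℕ => ((k : ℝ) + 1) ^ 2 * upperCoeffIter 4 J c b 1 n k)
      (fun k hk => mul_nonneg (sq_nonneg _) (hcn k (Finset.mem_Icc.mp hk).1)) (Finset.mem_Icc.mpr ⟨hj1, hjJ⟩))
    have h1 : (1 : ℝ) ≤ ((j : ℝ) + 1) ^ 2 := by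
      have : (1 : ℝ) ≤ (j : ℝ) + 1 := by linarith [show (0 : ℝ) ≤ j from Nat.cast_nonneg j]
      nlinarith
    exact le_mul_of_one_le_left (hcn j hj1) h1
  · rw [abs_zero]
    exact coeffNorm_nonneg' hcn

end Tomboulis2007

end Literature.MathematicalPhysics.QuantumFieldTheory

end

/-! ## Revision 1 (append-only, lit-2 g25): §2.1 «f_p(U, n) > 0 given that this holds for n = 0» — STRICT positivity of
the plaquette function along the upper-bound column at `r = 1`, `d = 4`

arXiv:0707.2179 §2.1 (p. 8, after (2.9)): "It is easily seen that `f_p(U, n) > 0` given that this holds for `n = 0`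
(cf. (2.6), (2.9))."  At `r = 1` the iterates are normalised convolution powers of pointwise powers (IS07 (2.2)–(2.3)), so
strict positivity propagates; here it is read off Ito's curvature induction `mkIterFun_spec_of_curv` (which carries
`0 < f^{(n)}` along) and the identification `mkIterFun_plaqFn`.  (For `r < 1` the coefficients are real powers `ĉ_j^{b²r}` and
no such statement is printed or claimed here; the non-strict `0 ≤ f` at `r = 1` is `SU2CharacterConvolution.plaqFn_upperCoeffIter_one_nonneg`.)
-/

namespace Literature.MathematicalPhysics.QuantumFieldTheory

namespace Tomboulis2007

open MeasureTheory Filter Topology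

/-- **The Ito–Seiler iterates of a positive plaquette function are positive**: `0 < f_c^{(n)}(U)` for `f_c > 0`, every
integer `b ≥ 2`, every `n` (IS07 (2.2)–(2.3) at `r = 1`; T07 §2.1: "It is easily seen that `f_p(U,n) > 0` given that this
holds for `n = 0`"). [cite: Tomboulis2007Confinement, §2.1 (text after eq. (2.9))] [cite: ItoSeiler2007Tomboulis, §2 eqs. (2.2)–(2.3)] -/
theorem mkIterFun_plaqFn_pos {J : ℕ} {c : ℕ → ℝ} (hf : ∀ U : SU2, 0 < plaqFn J c U) {b : ℕ} (hb : 2 ≤ b) (n : ℕ)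
    (U : SU2) : 0 < mkIterFun b n (plaqFn J c) U := by
  obtain ⟨f₁, f₂, B₀, hB₀, hfc, hfC, hf₁, hf₂, hdf, hdf', hcurv⟩ := plaqFn_itoDatum hf
  obtain ⟨B, F₁, F₂, -, -, -, -, -, -, hpos, -⟩ :=
    mkIterFun_spec_of_curv hfc hfC hf₁ hf₂ hf hdf hdf' hB₀ hcurv (integral_plaqFn J c) hb n
  exact hpos U

/-- **§2.1 STRICT positivity along the upper-bound column of scheme (3.38) at `r = 1`, `d = 4`**: for initial coefficients
`c_j ≥ 0` (`j ≥ 1`) with `f_c > 0` and every integer `b ≥ 2`, the plaquette function of the `n`-th upper-bound (= standard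
Migdal–Kadanoff) coefficient vector is strictly positive on `SU(2)`: `0 < f_{c^U(n)}(U)` (cut-off `b^{2n} J`).
[cite: Tomboulis2007Confinement, §2.1 (text after eq. (2.9)) and §3.4 scheme (3.38)] -/
theorem plaqFn_upperCoeffIter_four_one_pos {J : ℕ} {c : ℕ → ℝ} (hc : ∀ n, 1 ≤ n → 0 ≤ c n)
    (hf : ∀ U : SU2, 0 < plaqFn J c U) {b : ℕ} (hb : 2 ≤ b) (n : ℕ) (U : SU2) :
    0 < plaqFn (cutoffIter 4 J b n) (upperCoeffIter 4 J c b 1 n) U := by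
  rw [← mkIterFun_plaqFn hc (le_trans (by norm_num) hb) n]
  exact mkIterFun_plaqFn_pos hf hb n U

/-- The upper-bound coefficients at `r = 1`, `d = 4` are the character coefficients of the Ito–Seiler iterates:
`c^U_j(n) = ∫ f_c^{(n)} χ_j/d_j` for `1 ≤ j ≤ b^{2n} J` (so every statement about `f_c^{(n)}` — positivity above, uniform
convergence in `mkIterFun_plaqFn_tendstoUniformly_one` — transfers to the column of scheme (3.38)).
[cite: Tomboulis2007Confinement, §2 eqs. (2.19)–(2.22) and §3.4 scheme (3.38)] [cite: ItoSeiler2007Tomboulis, §2 eqs. (2.2)–(2.3)] -/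
theorem upperCoeffIter_four_one_eq_charCoeff_mkIterFun {J : ℕ} {c : ℕ → ℝ} (hc : ∀ n, 1 ≤ n → 0 ≤ c n)
    {b : ℕ} (hb : 1 ≤ b) (n j : ℕ) (hj : 1 ≤ j) (hjJ : j ≤ cutoffIter 4 J b n) :
    upperCoeffIter 4 J c b 1 n j = charCoeff (mkIterFun b n (plaqFn J c)) j := by
  rw [mkIterFun_plaqFn hc hb n, charCoeff_plaqFn, if_neg (by omega), if_pos hjJ]

end Tomboulis2007

end Literature.MathematicalPhysics.QuantumFieldTheory
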